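import Mathlib
import HarnessLib
import Literature.Combinatorics.Additive.StepBeyondKempermanTypes

/-!
# Grynkiewicz 2009, §6: «type (VIII) would imply `d⊆(A, QP) = 1`» — a member of a type (VIII) pair is
# one element away from a quasi-periodic set

[cite: Grynkiewicz2009, §4 (type (VIII)), §6 Claim 9 (p. 28) and Subcase 4 (p. 33)] [tag: critical-pair] [tag: inverse-theorem]

Topic `Literature/Combinatorics/Additive`.  Cell `mm-stpp` (D-0046), seat `mm-stpp-lit` (gen 24); the
port of D. J. Grynkiewicz, *A step beyond Kemperman's structure theorem*, Mathematika **55** (2009)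
67–114 continued.  In the deep core of §6 a decomposition returned by the induction hypothesis is
repeatedly refused the bottom type (VIII) with the words «type (VIII) would imply `d⊆(A, QP) = 1`»
(Claim 9, p. 28) and «Since `d⊆(B, QP) ≥ 2` (eq. (47)), it follows that we cannot have type (VIII)»
(Subcase 4, p. 33).  This file proves that sentence from the tree's rendering of type (VIII)
(`IsTypeVIII`, `StepBeyondKempermanTypes.lean`): «there exists a subgroup `K ≅ ℤ/2ℤ × ℤ/2ℤ` such that
`(φ_K(A), φ_K(B))` is of type (II), `A`, `B` and `A + B` are aperiodic, and `d⊆(A, A + K) = d⊆(B, B + K) = 4`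
with each of the 4 end terms of `φ_K(A)` and `φ_K(B)` containing exactly 2 `K`-holes» (print p. 10).

THE ARGUMENT (implicit in print).  The two end cosets of `φ_K(A)` are distinct (the `m + n − 1` cosets of
the sum progression are, by the cardinality clause of `IsTypeVIII`); they carry all four `K`-holes of `A`,
so every other coset meeting `A` is full.  `A` meets its first coset in two points `p, q`; `e = q − p` is a
non-zero element of the elementary abelian `K`, so `{p, q} = p + ⟨e⟩`.  `A` meets its last coset in two
points `r, s`; if `{r, s}` were `e`-invariant, `A` would be `e`-periodic — it is aperiodic.  Hence, say,
`r + e ∉ A`, and `A ∪ {r + e} = (A ∖ {s} ∪ {r + e}) ∪ {s}` is a quasi-periodic decomposition (the first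
part is `e`-invariant and nonempty, the second a single point): `d⊆(A, 𝒬𝒫) ≤ 1`
(`IsTypeVIII.subsetDist_isQuasiPeriodic_le_one_left`, and `_right` by symmetry).

WHAT THIS FILE IS NOT: no new definitions, no named facts; nothing about `d⊆(A + B, ·)` for type (VIII)
(Corollary 4.3's business).

## References
* D. J. Grynkiewicz, *A step beyond Kemperman's structure theorem*, Mathematika 55 (2009) 67–114,
  doi:10.1112/S0025579300000966; §4 p. 10 (type (VIII)), §6 pp. 28, 33 (held
  `paper:doi-10-1112-s0025579300000966`) [cite: Grynkiewicz2009, §4 (type (VIII))].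
-/

namespace Literature.Combinatorics.Additive

open Finset
open scoped Pointwise

universe u

variable {G : Type u} [AddCommGroup G] [DecidableEq G]

namespace IsTypeVIII

/-- Membership in a coset `c + K` of a subgroup carried by the finset `Kf`. [folklore] -/
private theorem mem_coset_iff {K : AddSubgroup G} {Kf : Finset G} (hKf : ∀ g, g ∈ Kf ↔ g ∈ K)
    {c z : G} : z ∈ c +ᵥ Kf ↔ z - c ∈ K := by
  rw [mem_vadd_finset]
  constructor
  · rintro ⟨k, hk, rfl⟩
    rw [vadd_eq_add, add_sub_cancel_left]
    exact (hKf k).1 hk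
  · intro h
    exact ⟨z - c, (hKf _).2 h, by rw [vadd_eq_add, add_sub_cancel]⟩

/-- The cosets of the sum progression are distinct: no multiple `i d`, `0 < i < m + n − 1`, lies in `K`
(from `|{a + b, …, a + b + (m+n−2)d} + K| = 4(m + n − 1)`): otherwise the progression plus `K` is covered
by its first `i` cosets. [cite: Grynkiewicz2009, §4 (type (VIII): «(φ_K(A), φ_K(B)) is of type (II)»)] -/
theorem nsmul_notMem {K : AddSubgroup G} {Kf : Finset G} (hKf : ∀ g, g ∈ Kf ↔ g ∈ K) (hK4 : #Kf = 4)
    {c d : G} {N i : ℕ} (hord : #(apFinset c d N + Kf) = 4 * N) (hi : 0 < i) (hiN : i < N) :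
    i • d ∉ K := by
  intro hid
  have hsub : apFinset c d N + Kf ⊆ apFinset c d i + Kf := by
    intro x hx
    obtain ⟨p, hp, k, hk, rfl⟩ := mem_add.1 hx
    obtain ⟨j, hj, rfl⟩ := mem_apFinset.1 hp
    have hdecomp : j • d = (j % i) • d + (j / i) • (i • d) := by
      rw [← mul_nsmul', ← add_nsmul, Nat.mod_add_div']
    refine mem_add.2 ⟨c + (j % i) • d, mem_apFinset.2 ⟨j % i, Nat.mod_lt j hi, rfl⟩,
      (j / i) • (i • d) + k, (hKf _).2 (K.add_mem (K.nsmul_mem hid _) ((hKf k).1 hk)), ?_⟩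
    rw [hdecomp]; abel
  have h1 : #(apFinset c d i + Kf) ≤ i * 4 := by
    refine (card_add_le).trans ?_
    rw [hK4]
    exact Nat.mul_le_mul_right 4 (card_apFinset_le c d i)
  have h2 := card_le_card hsub
  rw [hord] at h2
  have : 4 * N ≤ i * 4 := h2.trans h1
  omega

/-- **«type (VIII) would imply `d⊆(A, QP) = 1`»** (for the first member): if `(A, B)` is of type (VIII),
then `d⊆(A, 𝒬𝒫) ≤ 1`. [cite: Grynkiewicz2009, §6 Claim 9 (p. 28), Subcase 4 (p. 33); §4 (type (VIII))] -/
theorem subsetDist_isQuasiPeriodic_le_one_left {A B : Finset G} (h : IsTypeVIII A B) :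
    subsetDist A {P | IsQuasiPeriodic P} ≤ 1 := by
  obtain ⟨hAp, -, -, K, Kf, hKf, hK4, hK2, a, b, d, m, n, ha, -, hm, hn, hAK, -, hord,
    hcA, -, he1, he2, -, -⟩ := h
  set a' := a + (m - 1) • d with ha'
  have h0K : (0 : G) ∈ Kf := (hKf 0).2 K.zero_mem
  -- the two end cosets of `A` are distinct
  have hdist : a' - a ∉ K := by
    rw [ha', add_sub_cancel_left]
    refine nsmul_notMem hKf hK4 hord (by omega) (by omega)
  have hcos : ∀ {x y c c' : G}, x - c ∈ K → y - c' ∈ K → c' - c ∉ K → x ≠ y := by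
    intro x y c c' hx hy hcc' hxy
    subst hxy
    apply hcc'
    have : c' - c = (x - c) - (x - c') := by abel
    rw [this]; exact K.sub_mem hx hy
  -- the traces of `A` on its end cosets have two elements each
  have hX₀c : #((a +ᵥ Kf) ∩ A) = 2 := by
    have := card_sdiff_add_card_inter (a +ᵥ Kf) A
    rw [he1, card_vadd_finset, hK4] at this
    omega
  have hX₁c : #((a' +ᵥ Kf) ∩ A) = 2 := by
    have := card_sdiff_add_card_inter (a' +ᵥ Kf) A
    rw [he2, card_vadd_finset, hK4] at this
    omega
  obtain ⟨p, q, hpq, hX₀⟩ := card_eq_two.1 hX₀c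
  obtain ⟨r, s, hrs, hX₁⟩ := card_eq_two.1 hX₁c
  have hmem₀ : ∀ x, x ∈ (a +ᵥ Kf) ∩ A ↔ x - a ∈ K ∧ x ∈ A := fun x => by
    rw [mem_inter, mem_coset_iff hKf]
  have hmem₁ : ∀ x, x ∈ (a' +ᵥ Kf) ∩ A ↔ x - a' ∈ K ∧ x ∈ A := fun x => by
    rw [mem_inter, mem_coset_iff hKf]
  have hp := (hmem₀ p).1 (by rw [hX₀]; simp)
  have hq := (hmem₀ q).1 (by rw [hX₀]; simp)
  have hr := (hmem₁ r).1 (by rw [hX₁]; simp)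
  have hs := (hmem₁ s).1 (by rw [hX₁]; simp)
  -- every element of `A` in the first (last) coset is `p` or `q` (`r` or `s`)
  have hin₀ : ∀ x ∈ A, x - a ∈ K → x = p ∨ x = q := fun x hx hxa => by
    have : x ∈ (a +ᵥ Kf) ∩ A := (hmem₀ x).2 ⟨hxa, hx⟩
    rw [hX₀] at this; simpa using this
  have hin₁ : ∀ x ∈ A, x - a' ∈ K → x = r ∨ x = s := fun x hx hxa => by
    have : x ∈ (a' +ᵥ Kf) ∩ A := (hmem₁ x).2 ⟨hxa, hx⟩
    rw [hX₁] at this; simpa using this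
  -- the four holes of `A` lie in the two end cosets; all other cosets meeting `A` are full
  have hAsub : A ⊆ A + Kf := fun x hx => by
    have := add_mem_add hx h0K; rwa [add_zero] at this
  have hholes : (A + Kf) \ A = ((a +ᵥ Kf) \ A) ∪ ((a' +ᵥ Kf) \ A) := by
    symm
    refine eq_of_subset_of_card_le ?_ ?_
    · refine union_subset (sdiff_subset_sdiff ?_ Subset.rfl) (sdiff_subset_sdiff ?_ Subset.rfl)
      · intro x hx
        obtain ⟨k, hk, rfl⟩ := mem_vadd_finset.1 hx
        exact add_mem_add ha hk
      · intro x hx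
        rw [mem_coset_iff hKf] at hx
        have : x = r + (x - r) := by abel
        rw [this]
        refine add_mem_add hr.2 ((hKf _).2 ?_)
        have e : x - r = (x - a') - (r - a') := by abel
        rw [e]; exact K.sub_mem hx hr.1
    · have hdisj : Disjoint ((a +ᵥ Kf) \ A) ((a' +ᵥ Kf) \ A) := by
        rw [disjoint_left]
        intro x hx hx'
        rw [mem_sdiff, mem_coset_iff hKf] at hx hx'
        exact hcos hx.1 hx'.1 hdist rfl
      rw [card_union_of_disjoint hdisj, he1, he2, card_sdiff_of_subset hAsub, hcA]
      omega
  have hfull : ∀ x ∈ A, x - a ∉ K → x - a' ∉ K → ∀ k ∈ Kf, x + k ∈ A := by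
    intro x hx hxa hxa' k hk
    by_contra hnot
    have hmem : x + k ∈ (A + Kf) \ A := mem_sdiff.2 ⟨add_mem_add hx hk, hnot⟩
    rw [hholes, mem_union, mem_sdiff, mem_sdiff, mem_coset_iff hKf, mem_coset_iff hKf] at hmem
    have hk' := (hKf k).1 hk
    rcases hmem with ⟨h1, -⟩ | ⟨h1, -⟩
    · apply hxa
      have : x - a = (x + k - a) - k := by abel
      rw [this]; exact K.sub_mem h1 hk'
    · apply hxa'
      have : x - a' = (x + k - a') - k := by abel
      rw [this]; exact K.sub_mem h1 hk'
  -- `e = q − p ∈ K ∖ 0`, `2e = 0`, `{p, q} = {p, p + e}`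
  set e := q - p with he
  have heK : e ∈ K := by
    have : e = (q - a) - (p - a) := by rw [he]; abel
    rw [this]; exact K.sub_mem hq.1 hp.1
  have he0 : e ≠ 0 := fun h0 => hpq (by rw [he, sub_eq_zero] at h0; exact h0.symm)
  have h2e : e + e = 0 := hK2 e heK
  have hpe : p + e = q := by rw [he]; abel
  have hqe : q + e = p := by
    have : q + e = p + (e + e) := by rw [he]; abel
    rw [this, h2e, add_zero]
  have heKf : e ∈ Kf := (hKf e).2 heK
  -- the last trace `{r, s}` is not `e`-invariant, since `A` is aperiodic
  have hnot : ¬ (r + e ∈ A ∧ s + e ∈ A) := by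
    rintro ⟨hre, hse⟩
    apply hAp
    have hAne : A.Nonempty := ⟨a, ha⟩
    refine (isPeriodic_iff_addStab_ne hAne).2 fun h0 => he0 ?_
    have hinv : e +ᵥ A = A := by
      refine eq_of_subset_of_card_le (fun y hy => ?_) (by rw [card_vadd_finset])
      obtain ⟨x, hx, rfl⟩ := mem_vadd_finset.1 hy
      rw [vadd_eq_add, add_comm]
      by_cases hxa : x - a ∈ K
      · rcases hin₀ x hx hxa with rfl | rfl
        · rw [hpe]; exact hq.2
        · rw [hqe]; exact hp.2
      by_cases hxa' : x - a' ∈ K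
      · rcases hin₁ x hx hxa' with rfl | rfl
        · exact hre
        · exact hse
      · exact hfull x hx hxa hxa' e heKf
    have : e ∈ A.addStab := (mem_addStab hAne).2 hinv
    rw [h0, mem_singleton] at this
    exact this
  -- choose the element `r₀ ∈ {r, s}` with `r₀ + e ∉ A`, the other one being `s₀`
  obtain ⟨r₀, s₀, hr₀, hs₀, hr₀s₀, hX₁', hz⟩ : ∃ r₀ s₀, (r₀ - a' ∈ K ∧ r₀ ∈ A) ∧ (s₀ - a' ∈ K ∧ s₀ ∈ A) ∧
      r₀ ≠ s₀ ∧ (∀ x ∈ A, x - a' ∈ K → x = r₀ ∨ x = s₀) ∧ r₀ + e ∉ A := by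
    by_cases hre : r + e ∈ A
    · refine ⟨s, r, hs, hr, hrs.symm, fun x hx hxa => (hin₁ x hx hxa).symm, fun hse => hnot ⟨hre, hse⟩⟩
    · exact ⟨r, s, hr, hs, hrs, hin₁, hre⟩
  set z := r₀ + e with hzdef
  have hzs₀ : z ≠ s₀ := fun h => hz (by rw [h]; exact hs₀.2)
  have hza' : z - a' ∈ K := by
    have : z - a' = (r₀ - a') + e := by rw [hzdef]; abel
    rw [this]; exact K.add_mem hr₀.1 heK
  -- `A ∪ {z} = (A ∖ {s₀} ∪ {z}) ∪ {s₀}` is a quasi-periodic decomposition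
  set P₁ := insert z (A.erase s₀) with hP₁
  have hP₁ne : P₁.Nonempty := insert_nonempty z _
  have hinvP : e +ᵥ P₁ = P₁ := by
    refine eq_of_subset_of_card_le (fun y hy => ?_) (by rw [card_vadd_finset])
    obtain ⟨x, hx, rfl⟩ := mem_vadd_finset.1 hy
    rw [vadd_eq_add, add_comm]
    rw [hP₁, mem_insert, mem_erase] at hx ⊢
    rcases hx with rfl | ⟨hxs₀, hx⟩
    · -- `z + e = r₀`
      right
      have hze : z + e = r₀ := by rw [hzdef, add_assoc, h2e, add_zero]
      rw [hze]
      exact ⟨hr₀s₀, hr₀.2⟩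
    · by_cases hxa : x - a ∈ K
      · right
        have hxe : x + e ∈ A ∧ x + e - a ∈ K := by
          rcases hin₀ x hx hxa with rfl | rfl
          · rw [hpe]; exact ⟨hq.2, hq.1⟩
          · rw [hqe]; exact ⟨hp.2, hp.1⟩
        exact ⟨hcos hxe.2 hs₀.1 hdist, hxe.1⟩
      by_cases hxa' : x - a' ∈ K
      · -- `x = r₀` (as `x ≠ s₀`), and `r₀ + e = z`
        rcases hX₁' x hx hxa' with rfl | rfl
        · exact Or.inl rfl
        · exact absurd rfl hxs₀
      · right
        refine ⟨?_, hfull x hx hxa hxa' e heKf⟩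
        intro hxs
        apply hxa'
        have : x - a' = (x + e - a') - e := by abel
        rw [this, hxs]
        exact K.sub_mem hs₀.1 heK
  have heP : e ∈ P₁.addStab := (mem_addStab hP₁ne).2 hinvP
  have hP₁per : P₁.addStab ≠ {0} := fun h0 => he0 (by rw [h0, mem_singleton] at heP; exact heP)
  obtain ⟨H, hH, hHP⟩ := (isPeriodic_iff_addStab_ne hP₁ne).2 hP₁per
  have hqp : IsQuasiPeriodic (P₁ ∪ {s₀}) :=
    isQuasiPeriodic_union_of_isPeriodicWith hH hHP hP₁ne fun x hx y hy => by
      rw [mem_singleton] at hx hy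
      rw [hx, hy, sub_self]
      exact H.zero_mem
  have hAz : insert z A = P₁ ∪ {s₀} := by
    ext y
    rw [hP₁, mem_union, mem_insert, mem_insert, mem_erase, mem_singleton]
    constructor
    · rintro (rfl | hy)
      · exact Or.inl (Or.inl rfl)
      · by_cases hys : y = s₀
        · exact Or.inr hys
        · exact Or.inl (Or.inr ⟨hys, hy⟩)
    · rintro ((rfl | ⟨-, hy⟩) | rfl)
      · exact Or.inl rfl
      · exact Or.inr hy
      · exact Or.inr hs₀.2
  have hzA : z ∉ A := hz
  have h := subsetDist_le (𝒮 := {P | IsQuasiPeriodic P}) (A := A) (B := insert z A)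
    (by rw [hAz]; exact hqp) (subset_insert z A)
  rw [insert_sdiff_of_notMem A hzA, sdiff_self, bot_eq_empty, Finset.insert_empty,
    card_singleton, Nat.cast_one] at h
  exact h

/-- **«Since `d⊆(B, QP) ≥ 2` … we cannot have type (VIII)»**: the same bound for the second member.
[cite: Grynkiewicz2009, §6 Subcase 4 (p. 33); §4 (type (VIII))] -/
theorem subsetDist_isQuasiPeriodic_le_one_right {A B : Finset G} (h : IsTypeVIII A B) :
    subsetDist B {P | IsQuasiPeriodic P} ≤ 1 :=
  h.symm.subsetDist_isQuasiPeriodic_le_one_left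

end IsTypeVIII

end Literature.Combinatorics.Additive
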